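import Literature.NumberTheory.Li1992.RallisLocalFactorSplitUnramifiedOfGenerator
import Literature.NumberTheory.Li1992.RallisLocalFactorSplitRamified
import Literature.NumberTheory.GelbartRogawski1991.FinLocalSplittingsSplitSphericalCoeffDarboux
import Literature.NumberTheory.Automorphic.Liu2021.Def411IrreducibleOfLemD1AsPrinted
import Literature.NumberTheory.Automorphic.Liu2021.Def411WeilCarriersSurvivalSplit
import HarnessLib

/-!
# [Li1992, Thm 2.1 (27)] — the local factors at the SPLIT places, assembled in the tree's currency `χ_{1,v}`, `ω_v = toRep ∘ s_v`

J.-S. Li, J. reine angew. Math. **428** (1992), Thm 2.1 (27) p. 184 (the Rallis inner product formula: for almost all `v` the local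
integral is the unramified one; at the remaining places a test vector makes it non-zero, §5 p. 206).  This file assembles the split-place
half of the local factors `I_v(Φ_v, Φ_v) = ∫_{U(J₁)(F_v)} ⟨ω_v(h·1)Φ_v, Φ_v⟩ conj χ_{1,v}(h) dh` for a restricted family of local splittings
`𝓢` and a continuous unitary character `χ₁` of the finite-adelic centre `E¹(𝔸_{F,f})`:

* **`eventually_forall_localFactor_unitVec_ne_zero_of_split`** — for all but finitely many `v`, at every `w ∣ v` split in `E` and every
  generator `z₀` of `U(J₁)(F_v) ∕ U(J₁)(𝒪_v)`: the local factor at the SPHERICAL vector `1_{𝒪_vᴺ}` is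
  `dh(U(J₁)(𝒪_v)) · μ'ᴺ(𝒪_vᴺ) · (1 − q_v^{-N}) ∕ |1 − u conj χ_{1,v}(z₀) q_v^{-N/2}|² ≠ 0` (`|u| = 1`) — ★ spherical coefficients
  (`FinLocalSplittingsSplitSphericalCoeffDarboux`) + ★ `RallisLocalFactorSplitUnramifiedOfGenerator` + the unramified clauses of `𝓢` and `χ₁`;
* `exists_generator_localPi_one_of_split` (§0) — a generator `z₀` of `U(J₁)(F_v) ∕ U(J₁)(𝒪_v)` at a split place (`J₁` a unit at `w`), and the
  hypothesis-free corollary **`eventually_forall_localFactor_unitVec_ne_zero_of_split'`** (`≠ 0` for a.e. `v`, every split `w`, every `dh`);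
* **`exists_testVector_localFactor_ne_zero_of_split_localCharOfCenter`** — at EVERY split place (no unramifiedness) some `Φ_v ∈ 𝒮(F_vᴺ)` has
  integrable local integrand and `I_v(Φ_v, Φ_v) ≠ 0` (★ `RallisLocalFactorSplitRamified`).

KERNEL only: theorems, no definition, no named fact, no `sorry`.  Cell hodgecm-mathlib, FLOOR 0, programme P4 (F4), crux item H413
(`--supports stmt-HodgeConjecture-24833`).  HC_CM is proved only modulo the printed citations until rung 0 closes; nothing here is a claim about them.

## References
* [Li1992] J.-S. Li, J. reine angew. Math. 428 (1992) 177–217 — Thm 2.1 (27) p. 184; §5 p. 206.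
* [TateThesis1967] J. Tate, in Cassels–Fröhlich (1967), Ch. XV §3.2 Lemma 3.2.1 (a continuous idele class character is unramified a.e.).
* [GelbartRogawski1991] S. Gelbart, J. Rogawski, Invent. Math. 105 (1991), §3.1 (3.1.3), §3.2.
-/

set_option autoImplicit false

noncomputable section

open NumberField IsDedekindDomain MeasureTheory Filter Set
open scoped Matrix NNReal Topology ComplexConjugate
open Literature.RepresentationTheory Literature.RepresentationTheory.HeisenbergGroup
open Literature.NumberTheory.Automorphic
open Literature.NumberTheory.Automorphic.UnitaryGroup
open Literature.NumberTheory.Automorphic.Liu2021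
open Literature.NumberTheory.GaloisRepresentations.IsNonarchimedeanLocalField

/-! ## §0 Generators of the split torus modulo its integral points -/

namespace Literature.NumberTheory.Automorphic.UnitaryGroup

variable {F E : Type} [Field F] [NumberField F] [Field E] [NumberField E] [Algebra F E]
variable (c : E ≃ₐ[F] E) (J₁ : Matrix (Fin 1) (Fin 1) E) {v : HeightOneSpectrum (𝓞 F)}

/-- **`U(J₁)(F_v) = ⊔_m z₀^m U(J₁)(𝒪_v)` at a split place**: if `w ∣ v` is split and `J₁ = (j)` is a unit at `w`, the pull-back `z₀` of a
uniformiser of `E_w^× ≅ U(J₁)(F_v)` (★ `localPiSplitEquiv`) generates `U(J₁)(F_v)` modulo `U(J₁)(𝒪_v) = GL₁(𝒪_w)`: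
every `h` is `k₀ z₀^m` with `k₀` integral (`m = -v_w(det h_w)`). [cite: TateThesis1967, §3.2 (`F_v^× = ⊔ ϖ^m 𝒪^×`)] -/
theorem exists_generator_localPi_one_of_split [Algebra.IsQuadraticExtension F E] (hc : c ≠ 1) (hJ₁c : (J₁.map c)ᵀ = J₁)
    (w : PlacesOver E v) (hw : c • w.1 ≠ w.1) (hj : Valued.v (algebraMap E (w.1.adicCompletion E) (J₁ 0 0)) = 1) :
    ∃ z₀ : localPi E c 1 J₁ v, ∀ h : localPi E c 1 J₁ v,
      ∃ (k₀ : localPi E c 1 J₁ v) (m : ℤ), k₀ ∈ localInt E c 1 J₁ v ∧ h = k₀ * z₀ ^ m := by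
  have hj0 : algebraMap E (w.1.adicCompletion E) (J₁ 0 0) ≠ 0 := fun h0 => by
    rw [h0, map_zero] at hj; exact zero_ne_one hj
  have hJw : IsUnit (placeForm J₁ w.1) := by
    rw [Matrix.isUnit_iff_isUnit_det, Matrix.det_fin_one]
    exact isUnit_iff_ne_zero.2 hj0
  have hJi : hJw.unit ∈ glInt 1 (w.1.adicCompletion E) := unit_placeForm_mem_glInt_one J₁ hJw hj
  set e := localPiSplitEquiv c J₁ hc hJ₁c w hw hJw with he
  -- a uniformiser `π` of `E_w` as `g₀ ∈ GL₁(E_w)`, `z₀ := e⁻¹ g₀`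
  obtain ⟨π, hπ⟩ := IsDedekindDomain.HeightOneSpectrum.valuation_exists_uniformizer E w.1
  have hπv : Valued.v (algebraMap E (w.1.adicCompletion E) π) = WithZero.exp (-1 : ℤ) := by
    rw [show algebraMap E (w.1.adicCompletion E) π = (π : w.1.adicCompletion E) from rfl,
      IsDedekindDomain.HeightOneSpectrum.valuedAdicCompletion_eq_valuation', hπ]
  have hπ0 : algebraMap E (w.1.adicCompletion E) π ≠ 0 := fun h0 => by
    rw [h0, map_zero] at hπv; exact WithZero.exp_ne_zero hπv.symm
  let g₀ : GL (Fin 1) (w.1.adicCompletion E) :=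
    Matrix.GeneralLinearGroup.mkOfDetNeZero !![algebraMap E (w.1.adicCompletion E) π]
      (by rw [Matrix.det_fin_one_of]; exact hπ0)
  have hg₀ : Valued.v ((Matrix.GeneralLinearGroup.det g₀ : (w.1.adicCompletion E)ˣ) : w.1.adicCompletion E) =
      WithZero.exp (-1 : ℤ) := by
    rw [Matrix.GeneralLinearGroup.val_det_apply, Matrix.GeneralLinearGroup.val_mkOfDetNeZero, Matrix.det_fin_one_of]
    exact hπv
  refine ⟨e.symm g₀, fun h => ?_⟩
  -- `m = -v_w(det h_w)`, `k₀ = h z₀^{-m}`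
  set y : (w.1.adicCompletion E)ˣ := Matrix.GeneralLinearGroup.det (e h) with hy
  have hy0 : Valued.v (y : w.1.adicCompletion E) ≠ 0 := (Valuation.ne_zero_iff _).2 (Units.ne_zero _)
  set m : ℤ := -WithZero.log (Valued.v (y : w.1.adicCompletion E)) with hm
  refine ⟨h * ((e.symm g₀) ^ m)⁻¹, m, ?_, by rw [inv_mul_cancel_right]⟩
  rw [← e.symm_apply_apply (h * ((e.symm g₀) ^ m)⁻¹), localPiSplitEquiv_symm_mem_localInt_iff c J₁ hc hJ₁c w hw hJw hJi,
    ← valued_det_eq_one_iff_mem_glInt_one, map_mul, map_inv, map_zpow, ContinuousMulEquiv.apply_symm_apply, map_mul, map_inv,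
    map_zpow, Units.val_mul, Units.val_inv_eq_inv_val, Units.val_zpow_eq_zpow_val, map_mul, map_inv₀, map_zpow₀, hg₀, ← hy,
    ← WithZero.exp_zsmul, smul_eq_mul, mul_neg, mul_one, ← WithZero.exp_neg, neg_neg, ← WithZero.exp_log hy0, ← WithZero.exp_add,
    hm, add_neg_cancel, WithZero.exp_zero]

end Literature.NumberTheory.Automorphic.UnitaryGroup

/-! ## §1 The split places in the tree's currency -/

namespace Literature.NumberTheory.GelbartRogawski1991.UnitaryDualPair.LocalSplitting.FinLocalSplittings

variable {F : Type} [Field F] [NumberField F] {E : Type} [Field E] [NumberField E] [Algebra F E]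
  [Algebra.IsQuadraticExtension F E] {c : E ≃ₐ[F] E} {N : ℕ} {δ : E} {hcδ : c δ = -δ} {hδ : δ ≠ 0} {d : F}
  {hd : δ * δ = algebraMap F E d} {T : Matrix (Fin N) (Fin N) F} {hT : T.IsSymm}
  {J : Matrix (Fin N) (Fin N) E} {hJ : J = T.map (algebraMap F E)}
  (𝓢 : FinLocalSplittings F E c N hcδ hδ hd T hT hJ) (J₁ : Matrix (Fin 1) (Fin 1) E) (hJ₁ : J₁ 0 0 ≠ 0)
  (hTd : IsUnit T.det)

/-- `0 ≤ (√(q^k))⁻¹ < 1` for `q > 1`, `k ≠ 0`. [folklore] -/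
private theorem inv_sqrt_pow_lt_one {q : ℝ} (hq : 1 < q) {k : ℕ} (hk : k ≠ 0) :
    0 ≤ (Real.sqrt (q ^ k))⁻¹ ∧ (Real.sqrt (q ^ k))⁻¹ < 1 := by
  refine ⟨inv_nonneg.2 (Real.sqrt_nonneg _), inv_lt_one_of_one_lt₀ ?_⟩
  rw [Real.lt_sqrt zero_le_one, one_pow]
  exact one_lt_pow₀ hq hk

include hTd in
/-- **[Li1992 (27)] AT THE SPLIT UNRAMIFIED PLACES, IN THE TREE'S CURRENCY.**  For a restricted family `𝓢` of local splittings with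
`ω_v` `L²(μ'_vᴺ)`-isometric and a continuous unitary character `χ₁` of `E¹(𝔸_{F,f})`: for all but finitely many `v`, at every `w ∣ v` split
in `E` and every generator `z₀` of `U(J₁)(F_v)` modulo `U(J₁)(𝒪_v)`, for every left-invariant measure `dh` on `U(J₁)(F_v)` finite on compacts
and charging open sets, there is `u ∈ ℂ`, `|u| = 1`, with
`∫_{U(J₁)(F_v)} ⟨ω_v(h·1)1_{𝒪ᴺ}, 1_{𝒪ᴺ}⟩ conj χ_{1,v}(h) dh = dh(U(J₁)(𝒪_v)) · μ'_vᴺ(𝒪_vᴺ) · (1 − r_v²) ∕ |1 − u conj χ_{1,v}(z₀) r_v|² ≠ 0`,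
`r_v = (√(q_v^N))⁻¹`. [cite: Li1992, Thm 2.1 (27) p. 184] [cite: TateThesis1967, §3.2 Lemma 3.2.1] [cite: GelbartRogawski1991, §3.1 (3.1.3) p. 456] -/
theorem eventually_forall_localFactor_unitVec_ne_zero_of_split [NeZero N] (hJ₁c : (J₁.map c)ᵀ = J₁)
    {χ₁ : finAdelicOne F E c →* ℂˣ} (hχ₁ : Continuous χ₁) (hχ₁u : ∀ x, ‖((χ₁ x : ℂˣ) : ℂ)‖ = 1)
    [∀ v : HeightOneSpectrum (𝓞 F), MeasurableSpace (v.adicCompletion F)] [∀ v : HeightOneSpectrum (𝓞 F), BorelSpace (v.adicCompletion F)]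
    (μ' : ∀ v : HeightOneSpectrum (𝓞 F), Measure (v.adicCompletion F)) [∀ v, (μ' v).IsAddHaarMeasure]
    (hL2 : ∀ v : HeightOneSpectrum (𝓞 F), (𝓢.omegaLoc v).IsL2Isometric (Measure.pi fun _ : Fin N => μ' v)) :
    ∀ᶠ v : HeightOneSpectrum (𝓞 F) in cofinite, ∀ w : PlacesOver E v, c • w.1 ≠ w.1 →
      ∀ z₀ : localPi E c 1 J₁ v,
        (∀ h : localPi E c 1 J₁ v, ∃ (k₀ : localPi E c 1 J₁ v) (m : ℤ), k₀ ∈ localInt E c 1 J₁ v ∧ h = k₀ * z₀ ^ m) →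
        ∀ [MeasurableSpace (localPi E c 1 J₁ v)] [BorelSpace (localPi E c 1 J₁ v)] (dh : Measure (localPi E c 1 J₁ v))
          [dh.IsMulLeftInvariant] [IsFiniteMeasureOnCompacts dh] [dh.IsOpenPosMeasure],
        ∃ u : ℂ, ‖u‖ = 1 ∧
          (∫ h, (∫ x, ((𝓢.omegaLoc v (localCenter E c N J J₁ hJ₁ v h) (unitVec F (Fin N) v) :
                  SchwartzBruhat (Fin N → v.adicCompletion F)) : (Fin N → v.adicCompletion F) → ℂ) x *
                conj (((unitVec F (Fin N) v : SchwartzBruhat (Fin N → v.adicCompletion F)) : (Fin N → v.adicCompletion F) → ℂ) x)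
                ∂(Measure.pi fun _ : Fin N => μ' v)) *
              conj ((localCharOfCenter F E c J₁ hJ₁ χ₁ v h : ℂˣ) : ℂ) ∂dh =
            (dh.real (localInt E c 1 J₁ v : Set (localPi E c 1 J₁ v)) : ℂ) *
              ((Measure.pi fun _ : Fin N => μ' v).real (piPrimePowBall (v.adicCompletion F) (Fin N) 0) : ℂ) *
              (((1 - ((Real.sqrt ((residueFieldCard (v.adicCompletion F) : ℝ) ^ Fintype.card (Fin N)))⁻¹) ^ 2) /
                ‖1 - (u * conj ((localCharOfCenter F E c J₁ hJ₁ χ₁ v z₀ : ℂˣ) : ℂ)) *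
                  (Real.sqrt ((residueFieldCard (v.adicCompletion F) : ℝ) ^ Fintype.card (Fin N)))⁻¹‖ ^ 2 : ℝ) : ℂ)) ∧
          (∫ h, (∫ x, ((𝓢.omegaLoc v (localCenter E c N J J₁ hJ₁ v h) (unitVec F (Fin N) v) :
                  SchwartzBruhat (Fin N → v.adicCompletion F)) : (Fin N → v.adicCompletion F) → ℂ) x *
                conj (((unitVec F (Fin N) v : SchwartzBruhat (Fin N → v.adicCompletion F)) : (Fin N → v.adicCompletion F) → ℂ) x)
                ∂(Measure.pi fun _ : Fin N => μ' v)) *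
              conj ((localCharOfCenter F E c J₁ hJ₁ χ₁ v h : ℂˣ) : ℂ) ∂dh) ≠ 0 := by
  have hc : c ≠ 1 := by
    rintro rfl
    exact hδ (self_eq_neg.1 (by simpa only [AlgEquiv.one_apply] using hcδ))
  filter_upwards [𝓢.eventually_forall_exists_unit_sphericalCoeff J₁ hJ₁ hTd μ' hJ₁c hL2, 𝓢.unramified,
    eventually_localCharOfCenter_eq_one F E c J₁ hJ₁ hχ₁,
    eventually_forall_placesOver_valued_eq_one (F := F) (J₁ 0 0) hJ₁] with v hcoef hunr hχv hj
  intro w hw z₀ hz₀ _ _ dh _ _ _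
  haveI : SecondCountableTopology (v.adicCompletion F) := secondCountableTopology_localField _
  obtain ⟨u, hu, hcoefz⟩ := hcoef w hw z₀ hz₀
  have hq : (1 : ℝ) < (residueFieldCard (v.adicCompletion F) : ℝ) := Nat.one_lt_cast.2 (one_lt_residueFieldCard _)
  have hk : Fintype.card (Fin N) ≠ 0 := by rw [Fintype.card_fin]; exact NeZero.ne N
  obtain ⟨hr0, hr1⟩ := inv_sqrt_pow_lt_one hq hk
  refine ⟨u, hu, 𝓢.integral_localFactor_unitVec_ne_zero_of_generates J₁ hJ₁ v dh (Measure.pi fun _ : Fin N => μ' v)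
    (localCharOfCenter F E c J₁ hJ₁ χ₁ v) w z₀ hz₀ (valued_entry_eq_exp_or_of_generates F E c v hc hJ₁c w hw (hj w) z₀ hz₀)
    (fun k hk => hunr _ (localCenter_mapsTo_localInt E c N J J₁ hJ₁ v hk)) (fun k hk => hχv k hk)
    (norm_localCharOfCenter F E c J₁ hJ₁ hχ₁u v z₀)
    (Complex.ofReal_ne_zero.2 (measureReal_piPrimePowBall_pos _ 0).ne') hu hr0 hr1 hcoefz⟩

include hTd in
/-- **[Li1992 (27)] AT THE SPLIT UNRAMIFIED PLACES — HYPOTHESIS-FREE FORM**: for all but finitely many `v`, at every `w ∣ v` split in `E`, for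
every left-invariant `dh` finite on compacts charging open sets, the local factor at the spherical vector `1_{𝒪_vᴺ}` is NON-ZERO
(the generator `z₀` of `eventually_forall_localFactor_unitVec_ne_zero_of_split` exists by `exists_generator_localPi_one_of_split`).
[cite: Li1992, Thm 2.1 (27) p. 184] [cite: TateThesis1967, §3.2 Lemma 3.2.1] -/
theorem eventually_forall_localFactor_unitVec_ne_zero_of_split' [NeZero N] (hJ₁c : (J₁.map c)ᵀ = J₁)
    {χ₁ : finAdelicOne F E c →* ℂˣ} (hχ₁ : Continuous χ₁) (hχ₁u : ∀ x, ‖((χ₁ x : ℂˣ) : ℂ)‖ = 1)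
    [∀ v : HeightOneSpectrum (𝓞 F), MeasurableSpace (v.adicCompletion F)] [∀ v : HeightOneSpectrum (𝓞 F), BorelSpace (v.adicCompletion F)]
    (μ' : ∀ v : HeightOneSpectrum (𝓞 F), Measure (v.adicCompletion F)) [∀ v, (μ' v).IsAddHaarMeasure]
    (hL2 : ∀ v : HeightOneSpectrum (𝓞 F), (𝓢.omegaLoc v).IsL2Isometric (Measure.pi fun _ : Fin N => μ' v)) :
    ∀ᶠ v : HeightOneSpectrum (𝓞 F) in cofinite, ∀ w : PlacesOver E v, c • w.1 ≠ w.1 →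
      ∀ [MeasurableSpace (localPi E c 1 J₁ v)] [BorelSpace (localPi E c 1 J₁ v)] (dh : Measure (localPi E c 1 J₁ v))
        [dh.IsMulLeftInvariant] [IsFiniteMeasureOnCompacts dh] [dh.IsOpenPosMeasure],
        (∫ h, (∫ x, ((𝓢.omegaLoc v (localCenter E c N J J₁ hJ₁ v h) (unitVec F (Fin N) v) :
                SchwartzBruhat (Fin N → v.adicCompletion F)) : (Fin N → v.adicCompletion F) → ℂ) x *
              conj (((unitVec F (Fin N) v : SchwartzBruhat (Fin N → v.adicCompletion F)) : (Fin N → v.adicCompletion F) → ℂ) x)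
              ∂(Measure.pi fun _ : Fin N => μ' v)) *
            conj ((localCharOfCenter F E c J₁ hJ₁ χ₁ v h : ℂˣ) : ℂ) ∂dh) ≠ 0 := by
  have hc : c ≠ 1 := by
    rintro rfl
    exact hδ (self_eq_neg.1 (by simpa only [AlgEquiv.one_apply] using hcδ))
  filter_upwards [𝓢.eventually_forall_localFactor_unitVec_ne_zero_of_split J₁ hJ₁ hTd hJ₁c hχ₁ hχ₁u μ' hL2,
    eventually_forall_placesOver_valued_eq_one (F := F) (J₁ 0 0) hJ₁] with v hv hj
  intro w hw _ _ dh _ _ _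
  obtain ⟨z₀, hz₀⟩ := exists_generator_localPi_one_of_split c J₁ hc hJ₁c w hw (hj w)
  obtain ⟨u, -, -, hne⟩ := hv w hw z₀ hz₀ dh
  exact hne

include hTd in
/-- **[Li1992 (27)] AT EVERY SPLIT PLACE (RAMIFIED INCLUDED), IN THE TREE'S CURRENCY**: for `χ₁` continuous, `N ≥ 1`, any measure `dh` finite on
compacts and charging open sets, there is a test vector `Φ ∈ 𝒮(F_vᴺ)` with integrable local integrand and
`∫_{U(J₁)(F_v)} ⟨ω_v(h·1)Φ, Φ⟩ conj χ_{1,v}(h) dh ≠ 0`. [cite: Li1992, Thm 2.1 (27) p. 184; §5 p. 206] [cite: TateThesis1967, §3.2 Lemma 3.2.1] -/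
theorem exists_testVector_localFactor_ne_zero_of_split_localCharOfCenter [NeZero N] (hJ₁c : (J₁.map c)ᵀ = J₁)
    (v : HeightOneSpectrum (𝓞 F)) (w : PlacesOver E v) (hw : c • w.1 ≠ w.1) {χ₁ : finAdelicOne F E c →* ℂˣ} (hχ₁ : Continuous χ₁)
    [MeasurableSpace (localPi E c 1 J₁ v)] [BorelSpace (localPi E c 1 J₁ v)] (dh : Measure (localPi E c 1 J₁ v))
    [IsFiniteMeasureOnCompacts dh] [dh.IsOpenPosMeasure]
    [MeasurableSpace (v.adicCompletion F)] [BorelSpace (v.adicCompletion F)] (μ' : Measure (v.adicCompletion F)) [μ'.IsAddHaarMeasure] :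
    ∃ Φ : SchwartzBruhat (Fin N → v.adicCompletion F),
      Integrable (fun h : localPi E c 1 J₁ v => (∫ x, ((𝓢.omegaLoc v (localCenter E c N J J₁ hJ₁ v h) Φ :
            SchwartzBruhat (Fin N → v.adicCompletion F)) : (Fin N → v.adicCompletion F) → ℂ) x *
          conj (((Φ : SchwartzBruhat (Fin N → v.adicCompletion F)) : (Fin N → v.adicCompletion F) → ℂ) x)
          ∂(Measure.pi fun _ : Fin N => μ')) * conj ((localCharOfCenter F E c J₁ hJ₁ χ₁ v h : ℂˣ) : ℂ)) dh ∧
      (∫ h, (∫ x, ((𝓢.omegaLoc v (localCenter E c N J J₁ hJ₁ v h) Φ :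
            SchwartzBruhat (Fin N → v.adicCompletion F)) : (Fin N → v.adicCompletion F) → ℂ) x *
          conj (((Φ : SchwartzBruhat (Fin N → v.adicCompletion F)) : (Fin N → v.adicCompletion F) → ℂ) x)
          ∂(Measure.pi fun _ : Fin N => μ')) * conj ((localCharOfCenter F E c J₁ hJ₁ χ₁ v h : ℂˣ) : ℂ) ∂dh) ≠ 0 := by
  obtain ⟨Φ, -, -, -, -, -, -, -, hint, -, hne⟩ := 𝓢.exists_testVector_localFactor_ne_zero_of_split J₁ hJ₁ hTd v hJ₁c w hw dh μ'
    (localCharOfCenter F E c J₁ hJ₁ χ₁ v) (continuous_coe_localCharOfCenter F E c J₁ hJ₁ hχ₁ v)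
  exact ⟨Φ, hint, hne⟩

end Literature.NumberTheory.GelbartRogawski1991.UnitaryDualPair.LocalSplitting.FinLocalSplittings

end
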